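import Mathlib
import HarnessLib

/-!
# Truncation of covariances under exponential moments (uniform integrability bookkeeping)

Support file for the statement item `stmt-QuantumFields-12314`
(`Summit.QuantumFields.YangMills.Theses.DirichletWindow.LocalGaussianity`), line «exp-moment tangent law», stub
`stub_secondOrderLocalLaw`.  Pure measure theory, route-independent:

* `SecondOrder.pow_le_exp_half` — `x ≤ 2e^{x/2}`, `x² ≤ 8e^{x/2}`, `x³ ≤ 48e^{x/2}` (`x ≥ 0`);
* `SecondOrder.abs_mul_sub_clamp_mul_clamp_le`, `abs_sub_clamp_le` — `|xy − (x∧M)(y∧M)| ≤ (x³+y³)/M`,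
  `|x − x∧M| ≤ x²/M` for `x, y ≥ 0`, `M > 0` (the clamp is `t ↦ min (max t 0) M`);
* `SecondOrder.moments_le_of_exp` — `∫ f ≤ 2C`, `∫ f² ≤ 8C`, `∫ f³ ≤ 48C` from `∫ e^{f/2} ≤ C`, `0 ≤ f ≤ B`;
* `SecondOrder.abs_cov_sub_truncated_le` — on a probability space, for `0 ≤ f, g ≤ B` with `∫ e^{f/2}, ∫ e^{g/2} ≤ C`
  and `M > 0`: `|Cov(f,g) − Cov(f∧M, g∧M)| ≤ (96C + 32C²)/M`.

[folklore]; no rung or summit statement is proved here.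
-/

noncomputable section

open MeasureTheory Filter Topology

namespace Summit.QuantumFields.YangMills.Theorems.LocalGaussianityExpMomentTangentLaw

namespace SecondOrder

/-! ### Elementary inequalities for the truncation `t ↦ (t⁺) ∧ M` -/

/-- `x ≤ 2e^{x/2}`, `x² ≤ 8e^{x/2}`, `x³ ≤ 48e^{x/2}` for `x ≥ 0`. -/
theorem pow_le_exp_half {x : ℝ} (hx : 0 ≤ x) :
    x ≤ 2 * Real.exp (x / 2) ∧ x ^ 2 ≤ 8 * Real.exp (x / 2) ∧ x ^ 3 ≤ 48 * Real.exp (x / 2) := by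
  have hx2 : 0 ≤ x / 2 := by positivity
  have h1 := Real.pow_div_factorial_le_exp (x / 2) hx2 1
  have h2 := Real.pow_div_factorial_le_exp (x / 2) hx2 2
  have h3 := Real.pow_div_factorial_le_exp (x / 2) hx2 3
  simp only [Nat.factorial, Nat.succ_eq_add_one, Nat.reduceAdd, Nat.reduceMul, Nat.cast_ofNat,
    pow_one, Nat.cast_one, div_one] at h1 h2 h3
  refine ⟨by linarith, ?_, ?_⟩
  · have : (x / 2) ^ 2 / 2 = x ^ 2 / 8 := by ring
    rw [this] at h2
    linarith
  · have : (x / 2) ^ 3 / 6 = x ^ 3 / 48 := by ring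
    rw [this] at h3
    linarith

/-- **Truncation error for a product**: `|xy − (x ∧ M)(y ∧ M)| ≤ (x³ + y³)/M` for `x, y ≥ 0`, `M > 0`. -/
theorem abs_mul_sub_clamp_mul_clamp_le {x y M : ℝ} (hx : 0 ≤ x) (hy : 0 ≤ y) (hM : 0 < M) :
    |x * y - min (max x 0) M * min (max y 0) M| ≤ (x ^ 3 + y ^ 3) / M := by
  -- `a²b ≤ a³ + b³` for `a, b ≥ 0`
  have hcube : ∀ {a b : ℝ}, 0 ≤ a → 0 ≤ b → a ^ 2 * b ≤ a ^ 3 + b ^ 3 := by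
    intro a b ha hb
    rcases le_total a b with h | h
    · nlinarith [mul_nonneg (sq_nonneg a) (sub_nonneg.2 h), pow_nonneg hb 3,
        mul_nonneg (mul_nonneg hb hb) (sub_nonneg.2 h), mul_nonneg ha hb]
    · nlinarith [mul_nonneg (sq_nonneg a) (sub_nonneg.2 h), pow_nonneg hb 3]
  rw [max_eq_left hx, max_eq_left hy]
  have ha0 : 0 ≤ min x M := le_min hx hM.le
  have hb0 : 0 ≤ min y M := le_min hy hM.le
  have hab : min x M * min y M ≤ x * y := mul_le_mul (min_le_left _ _) (min_le_left _ _) hb0 hx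
  rw [abs_of_nonneg (by linarith), le_div_iff₀ hM]
  have hx3 : 0 ≤ x ^ 3 := pow_nonneg hx 3
  have hy3 : 0 ≤ y ^ 3 := pow_nonneg hy 3
  rcases le_total x M with hxM | hxM <;> rcases le_total y M with hyM | hyM
  · rw [min_eq_left hxM, min_eq_left hyM]
    nlinarith
  · rw [min_eq_left hxM, min_eq_right hyM]
    -- `M (xy − xM) ≤ M x y ≤ y x y = x y² ≤ x³ + y³`
    have h1 : (x * y - x * M) * M ≤ x * y * M := by nlinarith [mul_nonneg hx hM.le]
    have h2 : x * y * M ≤ x * y * y := by nlinarith [mul_nonneg hx hy]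
    nlinarith [hcube hy hx]
  · rw [min_eq_right hxM, min_eq_left hyM]
    have h1 : (x * y - M * y) * M ≤ x * y * M := by nlinarith [mul_nonneg hy hM.le]
    have h2 : x * y * M ≤ x * y * x := by nlinarith [mul_nonneg hx hy]
    nlinarith [hcube hx hy]
  · rw [min_eq_right hxM, min_eq_right hyM]
    have h1 : (x * y - M * M) * M ≤ x * y * M := by nlinarith [mul_nonneg hM.le hM.le]
    have h2 : x * y * M ≤ x * y * y := by nlinarith [mul_nonneg hx hy]
    nlinarith [hcube hy hx]

/-- **Truncation error**: `|x − x ∧ M| ≤ x²/M` for `x ≥ 0`, `M > 0`. -/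
theorem abs_sub_clamp_le {x M : ℝ} (hx : 0 ≤ x) (hM : 0 < M) :
    |x - min (max x 0) M| ≤ x ^ 2 / M := by
  rw [max_eq_left hx]
  rcases le_total x M with hxM | hxM
  · rw [min_eq_left hxM, sub_self, abs_zero]
    positivity
  · rw [min_eq_right hxM, abs_of_nonneg (by linarith), le_div_iff₀ hM]
    nlinarith

/-! ### The truncation error of a covariance under exponential moments -/

section Cov

variable {Ω : Type*} [MeasurableSpace Ω] {μ : Measure Ω} [IsProbabilityMeasure μ]

/-- Bounded a.e.-strongly measurable functions on a probability space are integrable. -/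
theorem integrable_of_abs_le {h : Ω → ℝ} (hm : AEStronglyMeasurable h μ) {K : ℝ}
    (hK : ∀ ω, |h ω| ≤ K) : Integrable h μ :=
  Integrable.of_bound hm K (ae_of_all _ fun ω => by rw [Real.norm_eq_abs]; exact hK ω)

/-- **Moments from the exponential moment**: for `0 ≤ f ≤ B` with `∫ e^{f/2} ≤ C`:
`∫ f ≤ 2C`, `∫ f² ≤ 8C`, `∫ f³ ≤ 48C`. -/
theorem moments_le_of_exp {f : Ω → ℝ} (hf : AEStronglyMeasurable f μ) (hf0 : ∀ ω, 0 ≤ f ω) {B : ℝ}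
    (hfB : ∀ ω, f ω ≤ B) {C : ℝ} (hfe : ∫ ω, Real.exp (f ω / 2) ∂μ ≤ C) :
    ∫ ω, f ω ∂μ ≤ 2 * C ∧ ∫ ω, f ω ^ 2 ∂μ ≤ 8 * C ∧ ∫ ω, f ω ^ 3 ∂μ ≤ 48 * C := by
  have hei : Integrable (fun ω => Real.exp (f ω / 2)) μ :=
    integrable_of_abs_le (by fun_prop) (K := Real.exp (B / 2)) fun ω => by
      rw [abs_of_pos (Real.exp_pos _)]
      exact Real.exp_le_exp.2 (by linarith [hfB ω])
  have hfi : ∀ k : ℕ, Integrable (fun ω => f ω ^ k) μ := fun k =>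
    integrable_of_abs_le (by fun_prop) (K := B ^ k) fun ω => by
      rw [abs_of_nonneg (pow_nonneg (hf0 ω) k)]
      exact pow_le_pow_left₀ (hf0 ω) (hfB ω) k
  refine ⟨?_, ?_, ?_⟩
  · calc ∫ ω, f ω ∂μ ≤ ∫ ω, 2 * Real.exp (f ω / 2) ∂μ :=
          integral_mono (by simpa using hfi 1) (hei.const_mul 2) fun ω => (pow_le_exp_half (hf0 ω)).1
      _ = 2 * ∫ ω, Real.exp (f ω / 2) ∂μ := integral_const_mul _ _
      _ ≤ 2 * C := by linarith
  · calc ∫ ω, f ω ^ 2 ∂μ ≤ ∫ ω, 8 * Real.exp (f ω / 2) ∂μ :=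
          integral_mono (hfi 2) (hei.const_mul 8) fun ω => (pow_le_exp_half (hf0 ω)).2.1
      _ = 8 * ∫ ω, Real.exp (f ω / 2) ∂μ := integral_const_mul _ _
      _ ≤ 8 * C := by linarith
  · calc ∫ ω, f ω ^ 3 ∂μ ≤ ∫ ω, 48 * Real.exp (f ω / 2) ∂μ :=
          integral_mono (hfi 3) (hei.const_mul 48) fun ω => (pow_le_exp_half (hf0 ω)).2.2
      _ = 48 * ∫ ω, Real.exp (f ω / 2) ∂μ := integral_const_mul _ _
      _ ≤ 48 * C := by linarith

/-- **The truncation error of a covariance under exponential moments.**  For `0 ≤ f, g ≤ B` on a probability space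
with `∫ e^{f/2}, ∫ e^{g/2} ≤ C` and `M > 0`:
`|Cov(f, g) − Cov(f ∧ M, g ∧ M)| ≤ (96 C + 32 C²)/M`. -/
theorem abs_cov_sub_truncated_le {f g : Ω → ℝ} (hf : AEStronglyMeasurable f μ) (hg : AEStronglyMeasurable g μ)
    (hf0 : ∀ ω, 0 ≤ f ω) (hg0 : ∀ ω, 0 ≤ g ω) {B : ℝ} (hfB : ∀ ω, f ω ≤ B) (hgB : ∀ ω, g ω ≤ B) {C : ℝ}
    (hfe : ∫ ω, Real.exp (f ω / 2) ∂μ ≤ C) (hge : ∫ ω, Real.exp (g ω / 2) ∂μ ≤ C) {M : ℝ} (hM : 0 < M) :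
    |((∫ ω, f ω * g ω ∂μ) - (∫ ω, f ω ∂μ) * (∫ ω, g ω ∂μ)) -
      ((∫ ω, min (max (f ω) 0) M * min (max (g ω) 0) M ∂μ) -
        (∫ ω, min (max (f ω) 0) M ∂μ) * (∫ ω, min (max (g ω) 0) M ∂μ))| ≤
      (96 * C + 32 * C ^ 2) / M := by
  -- integrability of everything in sight (all functions are bounded)
  have hB0 : ∀ ω, |f ω| ≤ B := fun ω => abs_le.2 ⟨by linarith [hf0 ω, hfB ω], hfB ω⟩
  have hB0' : ∀ ω, |g ω| ≤ B := fun ω => abs_le.2 ⟨by linarith [hg0 ω, hgB ω], hgB ω⟩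
  have hcm : ∀ {h : Ω → ℝ}, AEStronglyMeasurable h μ →
      AEStronglyMeasurable (fun ω => min (max (h ω) 0) M) μ := fun hh => by
    have : Continuous fun t : ℝ => min (max t 0) M := by fun_prop
    exact this.comp_aestronglyMeasurable hh
  have hcb : ∀ (h : Ω → ℝ) (ω : Ω), |min (max (h ω) 0) M| ≤ M := fun h ω => by
    rw [abs_of_nonneg (le_min (le_max_right _ _) hM.le)]
    exact min_le_right _ _
  have hfi : Integrable f μ := integrable_of_abs_le hf hB0
  have hgi : Integrable g μ := integrable_of_abs_le hg hB0'
  have hfgi : Integrable (fun ω => f ω * g ω) μ :=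
    integrable_of_abs_le (hf.mul hg) (K := B * B) fun ω => by
      rw [abs_mul]; exact mul_le_mul (hB0 ω) (hB0' ω) (abs_nonneg _) (by linarith [hf0 ω, hfB ω])
  have hcfi : Integrable (fun ω => min (max (f ω) 0) M) μ := integrable_of_abs_le (hcm hf) (hcb f)
  have hcgi : Integrable (fun ω => min (max (g ω) 0) M) μ := integrable_of_abs_le (hcm hg) (hcb g)
  have hccgi : Integrable (fun ω => min (max (f ω) 0) M * min (max (g ω) 0) M) μ :=
    integrable_of_abs_le ((hcm hf).mul (hcm hg)) (K := M * M) fun ω => by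
      rw [abs_mul]; exact mul_le_mul (hcb f ω) (hcb g ω) (abs_nonneg _) hM.le
  have hf3i : Integrable (fun ω => f ω ^ 3) μ :=
    integrable_of_abs_le (by fun_prop) (K := B ^ 3) fun ω => by
      rw [abs_of_nonneg (pow_nonneg (hf0 ω) 3)]; exact pow_le_pow_left₀ (hf0 ω) (hfB ω) 3
  have hg3i : Integrable (fun ω => g ω ^ 3) μ :=
    integrable_of_abs_le (by fun_prop) (K := B ^ 3) fun ω => by
      rw [abs_of_nonneg (pow_nonneg (hg0 ω) 3)]; exact pow_le_pow_left₀ (hg0 ω) (hgB ω) 3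
  have hf2i : Integrable (fun ω => f ω ^ 2) μ :=
    integrable_of_abs_le (by fun_prop) (K := B ^ 2) fun ω => by
      rw [abs_of_nonneg (pow_nonneg (hf0 ω) 2)]; exact pow_le_pow_left₀ (hf0 ω) (hfB ω) 2
  have hg2i : Integrable (fun ω => g ω ^ 2) μ :=
    integrable_of_abs_le (by fun_prop) (K := B ^ 2) fun ω => by
      rw [abs_of_nonneg (pow_nonneg (hg0 ω) 2)]; exact pow_le_pow_left₀ (hg0 ω) (hgB ω) 2
  -- the moment bounds
  obtain ⟨hf1, hf2, hf3⟩ := moments_le_of_exp hf hf0 hfB hfe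
  obtain ⟨hg1, hg2, hg3⟩ := moments_le_of_exp hg hg0 hgB hge
  have hC0 : 0 ≤ C := le_trans (integral_nonneg fun ω => (Real.exp_pos _).le) hfe
  -- term A: the product
  have hA : |(∫ ω, f ω * g ω ∂μ) - ∫ ω, min (max (f ω) 0) M * min (max (g ω) 0) M ∂μ| ≤ 96 * C / M := by
    rw [← integral_sub hfgi hccgi]
    calc |∫ ω, (f ω * g ω - min (max (f ω) 0) M * min (max (g ω) 0) M) ∂μ|
        ≤ ∫ ω, (f ω ^ 3 + g ω ^ 3) / M ∂μ := by
          refine (Real.norm_eq_abs _ ▸ norm_integral_le_of_norm_le ((hf3i.add hg3i).div_const M) ?_)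
          exact ae_of_all _ fun ω => by
            rw [Real.norm_eq_abs]; exact abs_mul_sub_clamp_mul_clamp_le (hf0 ω) (hg0 ω) hM
      _ = ((∫ ω, f ω ^ 3 ∂μ) + ∫ ω, g ω ^ 3 ∂μ) / M := by
          rw [integral_div, integral_add hf3i hg3i]
      _ ≤ 96 * C / M := by
          refine div_le_div_of_nonneg_right ?_ hM.le
          linarith
  -- term B: the means
  have hBf : |(∫ ω, f ω ∂μ) - ∫ ω, min (max (f ω) 0) M ∂μ| ≤ 8 * C / M := by
    rw [← integral_sub hfi hcfi]
    calc |∫ ω, (f ω - min (max (f ω) 0) M) ∂μ| ≤ ∫ ω, f ω ^ 2 / M ∂μ := by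
          refine (Real.norm_eq_abs _ ▸ norm_integral_le_of_norm_le (hf2i.div_const M) ?_)
          exact ae_of_all _ fun ω => by rw [Real.norm_eq_abs]; exact abs_sub_clamp_le (hf0 ω) hM
      _ = (∫ ω, f ω ^ 2 ∂μ) / M := integral_div _ _
      _ ≤ 8 * C / M := div_le_div_of_nonneg_right hf2 hM.le
  have hBg : |(∫ ω, g ω ∂μ) - ∫ ω, min (max (g ω) 0) M ∂μ| ≤ 8 * C / M := by
    rw [← integral_sub hgi hcgi]
    calc |∫ ω, (g ω - min (max (g ω) 0) M) ∂μ| ≤ ∫ ω, g ω ^ 2 / M ∂μ := by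
          refine (Real.norm_eq_abs _ ▸ norm_integral_le_of_norm_le (hg2i.div_const M) ?_)
          exact ae_of_all _ fun ω => by rw [Real.norm_eq_abs]; exact abs_sub_clamp_le (hg0 ω) hM
      _ = (∫ ω, g ω ^ 2 ∂μ) / M := integral_div _ _
      _ ≤ 8 * C / M := div_le_div_of_nonneg_right hg2 hM.le
  have hIg : |∫ ω, g ω ∂μ| ≤ 2 * C := by
    rw [abs_of_nonneg (integral_nonneg hg0)]; exact hg1
  have hIcf : |∫ ω, min (max (f ω) 0) M ∂μ| ≤ 2 * C := by
    rw [abs_of_nonneg (integral_nonneg fun ω => le_min (le_max_right _ _) hM.le)]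
    refine le_trans (integral_mono hcfi hfi fun ω => ?_) hf1
    rw [max_eq_left (hf0 ω)]; exact min_le_left _ _
  have hB : |(∫ ω, f ω ∂μ) * (∫ ω, g ω ∂μ) -
      (∫ ω, min (max (f ω) 0) M ∂μ) * (∫ ω, min (max (g ω) 0) M ∂μ)| ≤ 32 * C ^ 2 / M := by
    have hsplit : (∫ ω, f ω ∂μ) * (∫ ω, g ω ∂μ) -
        (∫ ω, min (max (f ω) 0) M ∂μ) * (∫ ω, min (max (g ω) 0) M ∂μ) =
        ((∫ ω, f ω ∂μ) - ∫ ω, min (max (f ω) 0) M ∂μ) * (∫ ω, g ω ∂μ) +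
          (∫ ω, min (max (f ω) 0) M ∂μ) * ((∫ ω, g ω ∂μ) - ∫ ω, min (max (g ω) 0) M ∂μ) := by ring
    rw [hsplit]
    calc _ ≤ |((∫ ω, f ω ∂μ) - ∫ ω, min (max (f ω) 0) M ∂μ) * (∫ ω, g ω ∂μ)| +
          |(∫ ω, min (max (f ω) 0) M ∂μ) * ((∫ ω, g ω ∂μ) - ∫ ω, min (max (g ω) 0) M ∂μ)| := abs_add_le _ _
      _ ≤ 8 * C / M * (2 * C) + 2 * C * (8 * C / M) := by
          rw [abs_mul, abs_mul]
          exact add_le_add (mul_le_mul hBf hIg (abs_nonneg _) (by positivity))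
            (mul_le_mul hIcf hBg (abs_nonneg _) (by positivity))
      _ = 32 * C ^ 2 / M := by ring
  -- conclusion
  have hre : ((∫ ω, f ω * g ω ∂μ) - (∫ ω, f ω ∂μ) * (∫ ω, g ω ∂μ)) -
      ((∫ ω, min (max (f ω) 0) M * min (max (g ω) 0) M ∂μ) -
        (∫ ω, min (max (f ω) 0) M ∂μ) * (∫ ω, min (max (g ω) 0) M ∂μ)) =
      ((∫ ω, f ω * g ω ∂μ) - ∫ ω, min (max (f ω) 0) M * min (max (g ω) 0) M ∂μ) -
        ((∫ ω, f ω ∂μ) * (∫ ω, g ω ∂μ) -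
          (∫ ω, min (max (f ω) 0) M ∂μ) * (∫ ω, min (max (g ω) 0) M ∂μ)) := by ring
  rw [hre]
  calc _ ≤ 96 * C / M + 32 * C ^ 2 / M := (abs_sub _ _).trans (add_le_add hA hB)
    _ = (96 * C + 32 * C ^ 2) / M := by ring

end Cov

end SecondOrder

end Summit.QuantumFields.YangMills.Theorems.LocalGaussianityExpMomentTangentLaw

end
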